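import Summits.CriticalPhenomena.CardyFormulaZ2.Theorems.CardyMeckeFlipMeckeRigidityDilationCovariance
import Summits.CriticalPhenomena.CardyFormulaZ2.Theorems.CardyMeckeFlipMeckeRigidityCylinderContinuity
import Mathlib.Topology.Algebra.Order.Archimedean
import Mathlib.Analysis.SpecialFunctions.Log.Basic

/-!
# The scale stabiliser of an exactly self-dual law is closed; scale trichotomy for models

Route `Summits/CriticalPhenomena/CardyFormulaZ2/Theses/CardyMeckeFlip`, crux `MeckeRigidity`
(item stmt-CriticalPhenomena-14826), line `registered`, similarity-covariance package (lead c3),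
registered sub-goals `map_dilate_eq_self_of_tendsto`, `scale_trichotomy`.

* **Closed stabiliser** (`map_dilate_eq_self_of_tendsto`): under exact self-duality (D) alone, if
  `(S_{uₙ})_* P = P` for a sequence of scales `uₙ → t > 0` then `(S_t)_* P = P`.  Two Borel probability
  laws on `ℋ_ℂ` agree as soon as they agree on finite intersections of crossing events (SS11 Thm 1.4(2),
  tree `borel_eq_generateFrom_generatePiSystem_crossedEvent`); on such an intersection the two sides are
  `P(⋂ ⊞_{S_{1/t} Qⱼ})` and `P(⋂ ⊞_{Qⱼ}) = P(⋂ ⊞_{S_{1/uₙ} Qⱼ})`, and the JOINT CONTINUITY of cylinder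
  probabilities under (D) (`continuous_measureReal_iInter_crossedEvent`) passes to the limit, since
  `S_{1/uₙ} Q → S_{1/t} Q` uniformly.
* **Scale trichotomy** (`scale_trichotomy`): for a model of (E2)+(D)+(ADM)+equivariance+(F)+(EXT) the
  log-scale stabiliser `H = {s : (S_{eˢ})_* P = P}` is a CLOSED subgroup of `(ℝ, +)` (group law:
  `S_s S_t = S_{st}`; closed: the previous theorem), off `H` the dilate is mutually SINGULAR to `P`
  (`map_dilate_eq_or_mutuallySingular_of`), and a closed subgroup of `ℝ` is everything or cyclic
  (`AddSubgroup.dense_or_cyclic`): the law is scale-invariant, or discretely scale-invariant with all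
  other dilates singular, or has pairwise singular dilates.  The uniqueness stub of the line must collapse
  this to the first case.
-/

noncomputable section

open MeasureTheory Set Metric Filter Topology
open scoped ENNReal NNReal
open Literature.Probability.Percolation Literature.Probability.Percolation.QuadCrossing

namespace Summit.CriticalPhenomena.CardyFormulaZ2.Theorems.CardyMeckeFlip

/-! ### Finite intersections of crossing events; dilated quads move continuously with the scale -/

/-- Every member of the π-system generated by the crossing events is a finite intersection of crossing
events. [folklore] -/
theorem exists_eq_iInter_crossedEvent_of_generatePiSystem {s : Set (QuadConfig (univ : Set ℂ))}
    (hs : s ∈ generatePiSystem (range (QuadConfig.crossedEvent (D := (univ : Set ℂ))))) :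
    ∃ (m : ℕ) (Qf : Fin m → Quad (univ : Set ℂ)), s = ⋂ j, QuadConfig.crossedEvent (Qf j) := by
  induction hs with
  | base h =>
    obtain ⟨Q, rfl⟩ := h
    exact ⟨1, fun _ => Q, by ext S; simp⟩
  | inter _ _ _ ihs iht =>
    obtain ⟨m, Qf, rfl⟩ := ihs
    obtain ⟨m', Qf', rfl⟩ := iht
    refine ⟨m + m', Fin.append Qf Qf', ?_⟩
    ext S
    simp only [mem_inter_iff, mem_iInter, QuadConfig.mem_crossedEvent]
    constructor
    · rintro ⟨h1, h2⟩ j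
      refine Fin.addCases (fun i => ?_) (fun i => ?_) j
      · simpa using h1 i
      · simpa using h2 i
    · intro h
      exact ⟨fun i => by simpa using h (Fin.castAdd m' i), fun i => by simpa using h (Fin.natAdd m i)⟩

/-- Dilated quads depend Lipschitz-continuously on the scale: `d(S_a Q, S_b Q) ≤ |a - b| · ‖Q‖_∞`.
[folklore] -/
theorem dist_quad_dilate_dilate_le (Q : Quad (univ : Set ℂ)) (a b : ℝ) (ha : a ≠ 0) (hb : b ≠ 0) :
    dist (Q.dilate a ha) (Q.dilate b hb) ≤ |a - b| * ‖Q.toContinuousMap‖ := by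
  rw [Quad.dist_eq, ContinuousMap.dist_le (by positivity)]
  intro z
  simp only [Quad.toContinuousMap_apply, quad_dilate_apply, dist_eq_norm, ← sub_mul, norm_mul,
    ← Complex.ofReal_sub, Complex.norm_real, Real.norm_eq_abs]
  exact mul_le_mul_of_nonneg_left (Q.toContinuousMap.norm_coe_le_norm z) (abs_nonneg _)

/-- Along a sequence of scales `uₙ → t` (all non-zero), `S_{uₙ} Q → S_t Q` in the quad metric. [folklore] -/
theorem tendsto_quad_dilate {u : ℕ → ℝ} (hu : ∀ n, u n ≠ 0) {t : ℝ} (ht : t ≠ 0)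
    (hut : Tendsto u atTop (𝓝 t)) (Q : Quad (univ : Set ℂ)) :
    Tendsto (fun n => Q.dilate (u n) (hu n)) atTop (𝓝 (Q.dilate t ht)) := by
  rw [tendsto_iff_dist_tendsto_zero]
  have h0 : Tendsto (fun n => |u n - t| * ‖Q.toContinuousMap‖) atTop (𝓝 0) := by
    have : Tendsto (fun n => |u n - t|) atTop (𝓝 0) := by
      simpa [sub_self, abs_zero] using (hut.sub_const t).abs
    simpa using this.mul_const ‖Q.toContinuousMap‖
  exact squeeze_zero (fun n => dist_nonneg) (fun n => dist_quad_dilate_dilate_le Q _ _ _ _) h0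

/-! ### The scale stabiliser is closed -/

/-- **Closedness of the scale stabiliser** (registered sub-goal `map_dilate_eq_self_of_tendsto` of item
stmt-CriticalPhenomena-14826): under (D), `(S_{uₙ})_* P = P` and `uₙ → t > 0` imply `(S_t)_* P = P`.
[folklore] -/
theorem map_dilate_eq_self_of_tendsto : ∀ (P : Measure (QuadConfig (Set.univ : Set ℂ))), IsProbabilityMeasure P → (∀ (n : ℕ) (Q Qt : Fin n → Quad (Set.univ : Set ℂ)), (∀ i, (Qt i).carrier = (Q i).carrier ∧ (Qt i).side 0 = (Q i).side 1 ∧ (Qt i).side 1 = (Q i).side 2 ∧ (Qt i).side 2 = (Q i).side 3 ∧ (Qt i).side 3 = (Q i).side 0) → ∀ A : Set (Set (Fin n)), P {S | {i | Q i ∈ S} ∈ A} = P {S | {i | Qt i ∉ S} ∈ A}) → ∀ (u : ℕ → ℝ) (hu : ∀ n, 0 < u n) (t : ℝ) (ht : 0 < t), Filter.Tendsto u Filter.atTop (nhds t) → (∀ n, Measure.map (QuadConfig.dilate (u n) (hu n).ne') P = P) → Measure.map (QuadConfig.dilate t ht.ne') P = P := by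
  intro P hP hD u hu t ht hut hinv
  haveI := hP
  haveI : IsProbabilityMeasure (Measure.map (QuadConfig.dilate t ht.ne') P) :=
    isProbabilityMeasure_map_dilate P t ht.ne'
  refine ext_of_generate_finite _
    (borel_eq_generateFrom_generatePiSystem_crossedEvent isOpen_univ univ_nonempty)
    (isPiSystem_generatePiSystem _) (fun s hs => ?_) (by simp)
  obtain ⟨m, Qf, rfl⟩ := exists_eq_iInter_crossedEvent_of_generatePiSystem hs
  have hmeas : MeasurableSet (⋂ j, QuadConfig.crossedEvent (Qf j)) :=
    MeasurableSet.iInter fun j => QuadConfig.measurableSet_crossedEvent _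
  -- the push-forward of an intersection of crossing events, at any scale
  have hmap : ∀ (a : ℝ) (ha : a ≠ 0), Measure.map (QuadConfig.dilate a ha) P (⋂ j, QuadConfig.crossedEvent (Qf j)) =
      P (⋂ j, QuadConfig.crossedEvent ((Qf j).dilate a⁻¹ (inv_ne_zero ha))) := by
    intro a ha
    rw [Measure.map_apply (measurable_quadConfig_dilate a ha) hmeas, preimage_iInter]
    simp_rw [preimage_dilate_crossedEvent]
  rw [hmap t ht.ne']
  -- along the sequence the value is constantly `P s`
  have hn : ∀ n, P.real (⋂ j, QuadConfig.crossedEvent ((Qf j).dilate (u n)⁻¹ (inv_ne_zero (hu n).ne'))) =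
      P.real (⋂ j, QuadConfig.crossedEvent (Qf j)) := by
    intro n
    have h := congrArg (fun μ : Measure (QuadConfig (univ : Set ℂ)) => μ (⋂ j, QuadConfig.crossedEvent (Qf j))) (hinv n)
    rw [hmap (u n) (hu n).ne'] at h
    simp only [Measure.real, h]
  -- continuity of cylinder probabilities along `S_{1/uₙ} Qf → S_{1/t} Qf`
  have hcont := continuous_measureReal_iInter_crossedEvent P hP hD m
  have hseq : Tendsto (fun n => fun j => (Qf j).dilate (u n)⁻¹ (inv_ne_zero (hu n).ne')) atTop
      (𝓝 fun j => (Qf j).dilate t⁻¹ (inv_ne_zero ht.ne')) := by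
    rw [tendsto_pi_nhds]
    intro j
    exact tendsto_quad_dilate (fun n => inv_ne_zero (hu n).ne') (inv_ne_zero ht.ne') (hut.inv₀ ht.ne') (Qf j)
  have hlim := (hcont.tendsto _).comp hseq
  have hfun : ((fun Q : Fin m → Quad (univ : Set ℂ) => P.real (⋂ j, QuadConfig.crossedEvent (Q j))) ∘
      fun n => fun j => (Qf j).dilate (u n)⁻¹ (inv_ne_zero (hu n).ne')) =
        fun _ => P.real (⋂ j, QuadConfig.crossedEvent (Qf j)) :=
    funext fun n => hn n
  rw [hfun] at hlim
  have heq : P.real (⋂ j, QuadConfig.crossedEvent ((Qf j).dilate t⁻¹ (inv_ne_zero ht.ne'))) =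
      P.real (⋂ j, QuadConfig.crossedEvent (Qf j)) :=
    tendsto_nhds_unique hlim tendsto_const_nhds
  exact (ENNReal.toReal_eq_toReal_iff' (measure_ne_top _ _) (measure_ne_top _ _)).1 heq

/-! ### Scale trichotomy -/

/-- Dilation maps with equal factors (and any proofs) agree as functions. [folklore] -/
theorem quadConfig_dilate_eq_of_eq {s t : ℝ} (hs : s ≠ 0) (ht : t ≠ 0) (h : s = t) :
    (QuadConfig.dilate s hs : QuadConfig (univ : Set ℂ) → QuadConfig univ) = QuadConfig.dilate t ht := by
  subst h; rfl

/-- **Scale trichotomy for models of the axioms** (registered sub-goal `scale_trichotomy` of item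
stmt-CriticalPhenomena-14826): the log-scale stabiliser is a closed subgroup of `ℝ`, equal to `ℝ` or
cyclic, and off it the dilates are mutually singular to the law. [folklore] -/
theorem scale_trichotomy : ∀ (P : Measure (QuadConfig (Set.univ : Set ℂ))) (M : ℝ → QuadConfig (Set.univ : Set ℂ) → Measure ℂ), IsProbabilityMeasure P → (∀ g : ℂ ≃ᵢ ℂ, Measure.map (QuadConfig.isometry g) P = P) → (∀ (n : ℕ) (Q Qt : Fin n → Quad (Set.univ : Set ℂ)), (∀ i, (Qt i).carrier = (Q i).carrier ∧ (Qt i).side 0 = (Q i).side 1 ∧ (Qt i).side 1 = (Q i).side 2 ∧ (Qt i).side 2 = (Q i).side 3 ∧ (Qt i).side 3 = (Q i).side 0) → ∀ A : Set (Set (Fin n)), P {S | {i | Q i ∈ S} ∈ A} = P {S | {i | Qt i ∉ S} ∈ A}) → IsAdmissibleKernel P M → IsIsometryEquivariant M → (∀ ε : ℝ, 0 < ε → IsFlipFairKernel P (M ε)) → IsFlipExtremal P M → ∃ H : AddSubgroup ℝ, IsClosed (H : Set ℝ) ∧ (∀ (t : ℝ) (ht : 0 < t), Measure.map (QuadConfig.dilate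 t ht.ne') P = P ↔ Real.log t ∈ H) ∧ (∀ (t : ℝ) (ht : 0 < t), Real.log t ∉ H → Measure.map (QuadConfig.dilate t ht.ne') P ⟂ₘ P) ∧ ((H : Set ℝ) = Set.univ ∨ ∃ a : ℝ, H = AddSubgroup.closure {a}) := by
  intro P M hP hE2 hD hADM hEq hF hEXT
  haveI := hP
  -- the log-scale stabiliser as a subgroup of `(ℝ, +)`
  let H : AddSubgroup ℝ :=
    { carrier := {s | Measure.map (QuadConfig.dilate (Real.exp s) (Real.exp_pos s).ne') P = P}
      zero_mem' := by
        simp only [mem_setOf_eq]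
        rw [quadConfig_dilate_eq_of_eq _ one_ne_zero Real.exp_zero]
        have : (QuadConfig.dilate 1 one_ne_zero : QuadConfig (univ : Set ℂ) → QuadConfig univ) = id :=
          funext quadConfig_dilate_one
        rw [this, Measure.map_id]
      add_mem' := fun {a b} ha hb => by
        simp only [mem_setOf_eq] at ha hb ⊢
        rw [quadConfig_dilate_eq_of_eq _ (mul_ne_zero (Real.exp_pos a).ne' (Real.exp_pos b).ne') (Real.exp_add a b)]
        exact map_dilate_mul_eq_self _ _ ha hb
      neg_mem' := fun {a} ha => by
        simp only [mem_setOf_eq] at ha ⊢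
        rw [quadConfig_dilate_eq_of_eq _ (inv_ne_zero (Real.exp_pos a).ne') (Real.exp_neg a)]
        exact map_dilate_inv_eq_self _ ha }
  have hmem : ∀ s : ℝ, s ∈ H ↔ Measure.map (QuadConfig.dilate (Real.exp s) (Real.exp_pos s).ne') P = P :=
    fun s => Iff.rfl
  -- membership read at `t = exp (log t)`
  have hlog : ∀ (t : ℝ) (ht : 0 < t), (Measure.map (QuadConfig.dilate t ht.ne') P = P ↔ Real.log t ∈ H) := by
    intro t ht
    rw [hmem, quadConfig_dilate_eq_of_eq _ ht.ne' (Real.exp_log ht)]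
  -- closedness, by sequences
  have hclosed : IsClosed (H : Set ℝ) := by
    refine IsSeqClosed.isClosed fun x p hx hxp => ?_
    have hx' : ∀ n, Measure.map (QuadConfig.dilate (Real.exp (x n)) (Real.exp_pos (x n)).ne') P = P :=
      fun n => (hmem (x n)).1 (hx n)
    exact (hmem p).2 (map_dilate_eq_self_of_tendsto P hP hD (fun n => Real.exp (x n)) (fun n => Real.exp_pos (x n))
      (Real.exp p) (Real.exp_pos p) ((Real.continuous_exp.tendsto p).comp hxp) hx')
  refine ⟨H, hclosed, hlog, fun t ht hnot => ?_, ?_⟩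
  · -- off the stabiliser: singular
    rcases map_dilate_eq_or_mutuallySingular_of hE2 hADM hEq hF hEXT t ht with h | h
    · exact (hnot ((hlog t ht).1 h)).elim
    · exact h
  · -- a closed subgroup of `ℝ` is everything or cyclic
    rcases AddSubgroup.dense_or_cyclic H with hd | ⟨a, ha⟩
    · left
      rw [← hclosed.closure_eq, hd.closure_eq]
    · right
      exact ⟨a, ha⟩

end Summit.CriticalPhenomena.CardyFormulaZ2.Theorems.CardyMeckeFlip

end
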